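import Summits.NavierStokesRegularity.FunctionalMining.TopEigHeatDanskin
import Literature.Analysis.FunctionSpaces.TorusInverseLaplacianCalculus
import HarnessLib

/-!
# FunctionalMining — the selection bound on a measurable set, and constant selections

Search for candidate a priori estimates; no regularity claim. Cell `pub-nsfunc`, prove seat
(gen 21). Two bookkeeping consequences of Danskin's formula
`heatDissipation (∫(λ₁⁺)^q) v = −∫ q λ₁^{q−1} μ(S; ΔS)` (`TopEigHeatDanskin.lean`), in the form the
no-go seat's F1 PART I uses them (§2, Corollary 2 "more generally" and Proposition 4; pen,
countersigned in the cell — not a cited fact):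

* **`TopEig.heatDissipation_topEigMoment_le_of_selection_on`** — for a measurable set `A` and an a.e.
  selection `e` of unit top eigenvectors ON `A` ONLY:
  `T(v) ≤ −∫_A q λ₁^{q−1} eᵀΔS e + ∫_{Aᶜ} q λ₁^{q−1} ‖ΔS‖` — "an upper bound for `T` may use, on the
  set where `λ₁` is degenerate, whichever top eigenvector is convenient; the exact integrand is kept
  off `A`" (no measurable-selection theorem is needed);
* `TopEig.quad_strainFlat_laplacian` — for a CONSTANT vector `e`: `eᵀ ΔS(x) e = Δ(eᵀ S e)(x)` (the
  Rayleigh form is a continuous linear functional of the tensor and commutes with `Δ`);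
* `TopEig.selectionDensity_const` (Proposition 4) — where a constant unit `e` is a top vector of
  `S(x)`: `λ₁(x) = eᵀS(x)e` and the selection density is `q λ₁^{q−1} Δ(eᵀSe)(x)`: only the "grad-λ"
  channel survives; wells and flat twin walls (`λ₁` locally constant along a constant top vector)
  contribute nothing.

[ours; folklore]
-/

noncomputable section

open MeasureTheory Set Filter Topology

namespace Summit.NavierStokesRegularity.FunctionalMining

open Literature.Analysis.FunctionSpaces Literature.Analysis.FluidPDE

namespace TopEig

variable {d : Type*} [Fintype d] [DecidableEq d] [Nonempty d]
variable {v : UnitAddTorus d → EuclideanSpace ℝ d}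

/-! ## 1. Corollary 2 on a measurable set -/

/-- **Selection upper bound on a measurable set (F1 PART I, Corollary 2, general form).** For smooth
divergence-free `v`, real `q ≥ 1`, a measurable set `A ⊆ T^d` and `e` with `e(x) ∈ E(S(x))` for a.e.
`x ∈ A` and `x ↦ q λ₁^{q−1} e(x)ᵀΔS(x)e(x)` integrable on `A`:
`heatDissipation (∫(λ₁⁺)^q) v ≤ −∫_A q λ₁^{q−1} eᵀΔS e + ∫_{Aᶜ} q λ₁^{q−1} ‖ΔS‖`. [ours] -/
theorem heatDissipation_topEigMoment_le_of_selection_on {q : ℝ} (hq : 1 ≤ q) (hv : Torus.IsSmooth v)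
    (hdiv : Torus.IsDivFree v) {A : Set (UnitAddTorus d)} (hA : MeasurableSet A)
    {e : UnitAddTorus d → d → ℝ} (he : ∀ᵐ x, x ∈ A → e x ∈ topEigSet (StrainL4.strainFlat v x))
    (hint : IntegrableOn (fun x => q * torusStrainTopEig v x ^ (q - 1) *
      quad (StrainL4.strainFlat (Torus.laplacian v) x) (e x)) A) :
    heatDissipation (torusTopEigMoment q) v ≤
      -(∫ x in A, q * torusStrainTopEig v x ^ (q - 1) *
          quad (StrainL4.strainFlat (Torus.laplacian v) x) (e x)) +
        ∫ x in Aᶜ, q * torusStrainTopEig v x ^ (q - 1) * ‖StrainL4.strainFlat (Torus.laplacian v) x‖ := by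
  have hD := integrable_danskinDensity hq hv hv.laplacian hdiv
  have hB := (continuous_danskinBound hq hv hv.laplacian).integrable_unitAddTorus
  rw [heatDissipation_topEigMoment_eq_integral hq hv hdiv, ← integral_add_compl hA hD, neg_add]
  refine add_le_add ?_ ?_
  · rw [neg_le_neg_iff]
    refine integral_mono_ae hint hD.integrableOn ((ae_restrict_iff' hA).2 ?_)
    filter_upwards [he] with x hx hxA
    have hl : 0 ≤ torusStrainTopEig v x := by
      rw [← lam_strainFlat]; exact lam_strainFlat_nonneg hv hdiv x
    exact mul_le_mul_of_nonneg_left (quad_le_dirTopEig _ (hx hxA))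
      (mul_nonneg (by linarith) (Real.rpow_nonneg hl _))
  · rw [neg_le, ← integral_neg]
    refine integral_mono_ae hB.integrableOn.neg hD.integrableOn (ae_of_all _ fun x => ?_)
    have h := abs_danskinDensity_le hq hv hdiv (Torus.laplacian v) x
    exact neg_le_of_abs_le h

/-! ## 2. Constant selections (Proposition 4) -/

omit [Nonempty d] in
/-- **For a constant vector `e`, `eᵀ ΔS(x) e = Δ(eᵀ S e)(x)`**: the Rayleigh form of a fixed vector is
a continuous linear functional of the tensor, and the strain commutes with the Laplacian
(`strainFlat_laplacian`). [folklore] -/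
theorem quad_strainFlat_laplacian (hv : Torus.IsSmooth v) (e : d → ℝ) (x : UnitAddTorus d) :
    quad (StrainL4.strainFlat (Torus.laplacian v) x) e =
      Torus.laplacian (fun y => quad (StrainL4.strainFlat v y) e) x := by
  -- the Rayleigh form as a continuous linear functional
  set L : EuclideanSpace ℝ (d × d) →L[ℝ] ℝ :=
    ∑ i, ∑ j, (e i * e j) • (EuclideanSpace.proj (i, j) : EuclideanSpace ℝ (d × d) →L[ℝ] ℝ) with hL
  have hLA : ∀ A : EuclideanSpace ℝ (d × d), L A = quad A e := by
    intro A
    simp only [hL, FunLike.coe_sum, Finset.sum_apply, FunLike.coe_smul, Pi.smul_apply, smul_eq_mul, quad]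
    refine Finset.sum_congr rfl fun i _ => Finset.sum_congr rfl fun j _ => ?_
    rw [show (EuclideanSpace.proj (i, j) : EuclideanSpace ℝ (d × d) →L[ℝ] ℝ) A = A (i, j) from rfl]
    ring
  have hfun : (fun y => quad (StrainL4.strainFlat v y) e) = L ∘ StrainL4.strainFlat v :=
    funext fun y => (hLA _).symm
  rw [strainFlat_laplacian hv x, ← hLA, hfun,
    Torus.laplacian_clm_comp_apply (StrainL4.isSmooth_strainFlat hv) L x]

omit [Nonempty d] in
/-- `x ↦ eᵀS(x)e` is smooth for a constant `e`. [folklore] -/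
theorem isSmooth_quad_strainFlat (hv : Torus.IsSmooth v) (e : d → ℝ) :
    Torus.IsSmooth (fun y => quad (StrainL4.strainFlat v y) e) := by
  have h : ∀ i j, Torus.IsSmooth (fun y => e i * StrainL4.strainFlat v y (i, j) * e j) := by
    intro i j
    have h1 : Torus.IsSmooth (fun y => StrainL4.strainFlat v y (i, j)) :=
      (StrainL4.isSmooth_strainFlat hv).comp_clm (EuclideanSpace.proj (i, j))
    unfold Torus.IsSmooth at h1 ⊢
    exact (contDiff_const.mul h1).mul contDiff_const
  unfold quad
  unfold Torus.IsSmooth at h ⊢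
  simp only [Torus.lift] at h ⊢
  exact ContDiff.sum fun i _ => ContDiff.sum fun j _ => h i j

/-- **Constant selections (F1 PART I, Proposition 4).** If a constant unit vector `e` is a top vector
of `S(x)` (`e ∈ E(S(x))`), then `λ₁(x) = eᵀS(x)e` and the selection density of Corollary 2 at `x` is
`q λ₁(x)^{q−1} eᵀΔS(x)e = q (eᵀS(x)e)^{q−1} Δ(eᵀSe)(x)` — only the "grad-λ" channel of the density
survives; where `eᵀSe` is locally constant (wells, flat twin walls with a constant top vector) it
vanishes. [ours] -/
theorem selectionDensity_const (hv : Torus.IsSmooth v) (q : ℝ) {e : d → ℝ} {x : UnitAddTorus d}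
    (hx : e ∈ topEigSet (StrainL4.strainFlat v x)) :
    torusStrainTopEig v x = quad (StrainL4.strainFlat v x) e ∧
      q * torusStrainTopEig v x ^ (q - 1) * quad (StrainL4.strainFlat (Torus.laplacian v) x) e =
        q * quad (StrainL4.strainFlat v x) e ^ (q - 1) *
          Torus.laplacian (fun y => quad (StrainL4.strainFlat v y) e) x := by
  have h1 : torusStrainTopEig v x = quad (StrainL4.strainFlat v x) e := by
    rw [← lam_strainFlat, hx.2]
  exact ⟨h1, by rw [h1, quad_strainFlat_laplacian hv e x]⟩

end TopEig

end Summit.NavierStokesRegularity.FunctionalMining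

end
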